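import Mathlib
import Literature.MathematicalPhysics.QuantumFieldTheory.Balaban1983to89.B2

/-!
# `Balaban1983to89.B2LargeField` — B2 §2.A pp. 556–560: the large-field / small-field apparatus of the upper
bound — the thresholds (2.2)–(2.3), the partitions of unity (2.4)–(2.6) (KERNEL), the small-field regions Λ₀,
Λ₁, Λ₂, … (2.7)–(2.8), the positivity bounds (2.11)–(2.12) (KERNEL, given the printed bounds on δm²), and the
small-field consequences (2.16)–(2.17) (KERNEL: parallel-transport telescoping along contours)

HONEST FRAMING (lit-balaban, verbatim): statement-level skeleton of published theorems with citation tags; proofs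
where landed; nothing here is a claim about the Yang–Mills mass gap.

B2 = T. Bałaban, *(Higgs)₂,₃ quantum fields in a finite volume. II. An upper bound*, Commun. Math. Phys. **86**,
555–594 (1982) [Balaban1982Higgs2] (held: `paper:balaban1982-cmp86-higgs23-ii`; journal page = PDF page + 554);
quotations from the ×2 renders `…/pages/1982-cmp86-higgs23-II/…-p003, p004, p005, p006-x2.png` (pp. 557–560) of the
cell `pub-balaban`.  Unit `lit-balaban-r14` (READER/TYPER of B1–B2); SKELETON rows B2-2.02 … B2-2.17 of
`run/shared/lean/pub/lit-balaban/SKELETON.md`.  RELATION TO THE TREE: `…Balaban1983to89.B2` (b2b-pv04/pv07) supplies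
`B2.pFn` = p(ε) = b₀(1 + log ε⁻¹)^p (p. 557), `B2.rFn` = r(ε) = R(1 + log ε⁻¹)^r ((2.7) p. 558), `B2.Params`, and the
typed (2.28), Lemma 2.4, Prop. 3.1, (3.42); nothing there is restated.  This module is imported by nothing yet.

THE SOURCE TEXT, verbatim.  p. 557 [PDF 3]: *"Now we will introduce the restrictions on the fields. Each restriction
is connected with some positive term of the action, so the restrictions will be on the absolute values of the fields,
their derivatives and the connections between the "old" and the "new" fields. If any of the following inequalities
holds |B(y) − (QA)(y)| > p(ε), |(∂A)(b)| > p(ε), |A(x)| > (1/(μ₀ε))p(ε), |ψ(y) − (Q(A)φ)(y)| > p(ε),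
|(D_Aφ)(b)| > p(ε), |φ(x)| > (1/(λε^{4−d})^{1/4})p(ε), (2.2) then the corresponding factor in (2.1) satisfies the
inequality exp(−(…)) < exp(−c₀p(ε)²), (2.3) with some positive constant c₀, e.g. c₀ = ½min{a,1}. The term on the
right side above is very small. It follows from the definition of p(ε) = b₀(1 + log ε⁻¹)^p, p > 2, that
exp(−c₀p(ε)²) is smaller than the arbitrary power ε^K … Let us denote by Λ* the set of all bonds contained in Λ, i.e.
with endpoints belonging to Λ, for arbitrary subset Λ ⊂ T₁. The following equality holds
1 = Σ_{P_v⊂T′₁} Σ_{Q_v⊂T*₁} Σ_{R_v⊂T₁} Π_{y∈P_v} χ({|B(y) − (QA)(y)| > p(ε)}) · Π_{y∈P_v^c} χ({|B(y) − (QA)(y)| ≤ p(ε)})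
Π_{b∈Q_v} χ({|(∂A)(b)| > p(ε)}) · Π_{b∈Q_v^c} χ({|(∂A)(b)| ≤ p(ε)}) Π_{x∈R_v} χ({|A(x)| > (1/(μ₀ε))p(ε)}) · Π_{x∈R_v^c}
χ({|A(x)| ≤ (1/(μ₀ε))p(ε)}) =: Σ_{P_v⊂T′₁} Σ_{Q_v⊂T*₁} Σ_{R_v⊂T₁} χ^c_{P_v}χ_{P_v^c}χ^c_{Q_v}χ_{Q_v^c}χ^c_{R_v}χ_{R_v^c}. (2.4)
An analogous equality for the scalar field is [(2.5), with ψ − Q(A)φ, D_Aφ, φ and the threshold (1/λ(ε)^{1/4})p(ε)],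
where λ(ε) = λε^{4−d}."*  p. 558 [PDF 4]: *"Unifying these two expansions, i.e. multiplying (2.4) and (2.5), we get a
joint expansion: 1 = Σ … χ^c_{P_v}χ_{P_v^c}χ^c_{P_s}χ_{P_s^c}·χ^c_{Q_v}χ_{Q_v^c}χ^c_{Q_s}χ_{Q_s^c}χ^c_{R_v}χ_{R_v^c}χ^c_{R_s}
χ_{R_s^c}. (2.6) … Let us define: Λ₀^c is the sum of all large blocks of T₁ distant from one of the sets B(P_v), Q_v,
R_v, B(P_s), Q_s, R_s less than r(ε) = R(1 + log ε⁻¹)^r. The numbers r, R satisfy r > 1, R > R₀ (R₀ occurs in the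
formulation of Proposition I.2.1). (2.7) Next let us define a sequence of sets Λ₁, Λ₂, … by an induction: Λ^c_{i+1}
is the sum of all large blocks of T₁ with distances from the set Λ^c_i less or equal r(ε). (2.8) … In the class of
ordered 6-tuples {P_v, Q_v, R_v, P_s, Q_s, R_s} the inclusion relation between the proper sets defines a natural partial
order relation. Thus, there are minimal elements in the class. Let us denote by Λ^{(*,′)}_{−1} the set of the points
(the bonds, the blocks) in T₁ distant from Λ₀ less than r(ε). It is easily seen that Σ_{{P_v,…,R_s} admissible}
χ^c_{P_v}χ_{P_v^c}·…·χ^c_{R_s}χ_{R_s^c} = Σ_{{P_v,…,R_s} admissible, minimal} χ^c_{P_v}χ^c_{P_s}χ^c_{Q_v}χ^c_{Q_s}χ^c_{R_v}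
χ^c_{R_s}χ_{Λ₋₁}, (2.9) … Further we have 1 = Σ_{Λ₀}[the expression on the right side of (2.9)]. (2.10)"*  p. 559
[PDF 5]: *"δm² = O(ε⁻¹) for d = 3 and δm² = O(1 + log ε⁻¹) for d = 2. Hence λ(ε)|φ|⁴ + ½δm²ε²|φ|² ≥ −O(ε^{κ₀}), (2.11)
where κ₀ = 1 for d = 3 and κ₀ = 2 − α with arbitary α > 0 for d = 2, and λ(ε)|φ|⁴ + ½δm²ε²|φ|² ≥ ½λ(ε)|φ|⁴ for
|φ|² ≥ O(1)(1 + log ε⁻¹). (2.12) … [(2.13)–(2.15)] … Let us analyse more precisely the restrictions on the fields in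
the domains Λ^{(*,′)}_{−1}. For each y ∈ Λ′, we have |ψ(y)| ≤ |L^{−d}Σ_{x∈B(y)}U(A(Γ_{y,x}))φ(x)| + p(ε) ≤ L^{−d}Σ_{x∈B(y)}
|φ(x)| + p(ε) ≤ (1/λ(ε)^{1/4})p(ε) + p(ε) ≤ (2/λ(ε)^{1/4})p(ε). Further, for arbitrary x ∈ B(y) |U(A(Γ_{y,x}))φ(x) −
φ(y)| = |Σ_{b⊂Γ_{y,x}} U(A(Γ_{y,b₋}))(D_Aφ)(b)| ≤ Σ_{b⊂Γ_{y,x}} |(D_Aφ)(b)| ≤ (L − 1)dp(ε), hence |(Q(A)φ)(y) − φ(y)| ≤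
(L − 1)dp(ε), |ψ(y) − φ(y)| ≤ Ldp(ε), and |ψ(y) − U(A(Γ_{y,x}))φ(x)| ≤ 2Ldp(ε)."*  p. 560 [PDF 6]: *"Let us gather the
estimates for the scalar fields on Λ₋₁: |ψ(y) − U(A(Γ_{y,x}))φ(x)| ≤ 2Ldp(ε) for x ∈ B(y), |ψ(y)| ≤ (2/λ(ε)^{1/4})p(ε)
for y ∈ Λ′₋₁, |U(A(⟨y,y′⟩))ψ(y′) − ψ(y)| ≤ 3Ldp(ε) for ⟨y,y′⟩ ∈ Λ′*₋₁. (2.16) The identical considerations can be done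
for vector fields and we get |B(y) − A(x)| ≤ 2Ldp(ε) for x ∈ B(y), and |B(y)| ≤ (2/(μ₀ε))p(ε) for y ∈ Λ′₋₁, |B(y) −
B(y′)| ≤ 3Ldp(ε) for ⟨y,y′⟩ ∈ Λ′*₋₁. (2.17) The same estimates as (2.16), (2.17) will hold for the fields in each step
with ε replaced by the corresponding L^kε."*

WHAT IS TYPED / KERNEL-CHECKED.  (2.2): the large-field thresholds (`thrA`, `thrPhi`, `lambdaEps` = λ(ε) of (2.5));
(2.3) and the remark *"exp(−c₀p(ε)²) is smaller than the arbitrary power ε^K"* as the named Prop `ExpPSqSmall`,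
KERNEL (v1.1, `expPSqSmall`: for c₀, b₀ > 0, p > ½ — so in particular for the printed p > 2, `expPSqSmall_of_printed` —
with the threshold ε₁ = e^{−T}, T = (K/c₀b₀²)^{1/(2p−1)}, from Kt ≤ c₀b₀²(1 + t)^{2p} for t = log ε⁻¹ ≥ T); (2.4)–(2.6): the partition of unity behind them, KERNEL (`sum_powerset_prod_eq_one`:
Σ_{P⊂S}Π_{y∈P}χ^c_yΠ_{y∈S∖P}χ_y = 1 whenever χ^c_y + χ_y = 1, Mathlib's `Finset.prod_add`; (2.4) is the product of three,
(2.6) of six such identities, `partition24`); (2.7)–(2.8): the sets Λ₀ ⊃ Λ₁ ⊃ Λ₂ ⊃ … CONCRETELY over a finite family of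
large blocks with a distance (`lambdaCompl`, with the printed "less than r(ε)" / "less or equal r(ε)"; KERNEL:
`lambdaCompl_mono` — the complements increase); (2.9)–(2.10), "admissible", "minimal": quoted, not typed (a
resummation convention; the word "admissible" for SEQUENCES of Λ₀'s, p. 566, is quoted in `…B2`); (2.11)–(2.12):
KERNEL as the two elementary inequalities they are for a quartic-plus-quadratic polynomial (`quartic_quadratic_lower`,
`quartic_quadratic_half`), the printed O(ε^{κ₀}) then following from the printed (B3-deferred) bounds on δm², which
enter as hypotheses (`display211`); (2.13)–(2.15): quoted (the E₁-split (2.14) is B3's), not typed; (2.16)–(2.17):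
KERNEL in the abstract — along any contour of m bonds the transported field differs from the field at the initial point
by at most Σ_b|(D_Aφ)(b)| (`norm_transport_sub_le`, isometric transports, telescoping), and a block average of
transported values differs from φ(y) by at most the maximal deviation (`norm_blockAvg_sub_le`); the printed constants
(L − 1)d, Ld, 2Ld then follow from |(D_Aφ)(b)| ≤ p(ε), the contour lengths ≤ (L − 1)d of (I.2.1) and
|ψ(y) − (Q(A)φ)(y)| ≤ p(ε) (`display216a`, `display216b`).
-/

open scoped BigOperators
open Finset

namespace Literature.MathematicalPhysics.QuantumFieldTheory.Balaban1983to89.B2LargeField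

/-! ## (2.2)–(2.3), (2.5) p. 557: the large-field thresholds -/

/-- λ(ε) = λε^{4−d} ((2.5) p. 557, *"where λ(ε) = λε^{4−d}"*; integer exponent, d = 2, 3 in the paper).
[cite: Balaban1982Higgs2, (2.5) p.557] -/
noncomputable def lambdaEps (lam ε : ℝ) (d : ℕ) : ℝ := lam * ε ^ ((4 : ℤ) - d)

/-- Unfolding lemma (definitional). [cite: Balaban1982Higgs2, (2.5) p.557] -/
theorem lambdaEps_eq (lam ε : ℝ) (d : ℕ) : lambdaEps lam ε d = lam * ε ^ ((4 : ℤ) - d) := rfl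

/-- λ(ε) > 0 for λ, ε > 0. [cite: Balaban1982Higgs2, (2.5) p.557] -/
theorem lambdaEps_pos {lam ε : ℝ} (hl : 0 < lam) (hε : 0 < ε) (d : ℕ) : 0 < lambdaEps lam ε d :=
  mul_pos hl (zpow_pos hε _)

/-- The large-field threshold for |A(x)| in (2.2): (1/(μ₀ε))p(ε). [cite: Balaban1982Higgs2, (2.2) p.557] -/
noncomputable def thrA (μ₀ ε pε : ℝ) : ℝ := pε / (μ₀ * ε)

/-- The large-field threshold for |φ(x)| in (2.2): (1/(λε^{4−d})^{1/4})p(ε) = p(ε)/λ(ε)^{1/4}.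
[cite: Balaban1982Higgs2, (2.2) p.557] -/
noncomputable def thrPhi (lam ε : ℝ) (d : ℕ) (pε : ℝ) : ℝ := pε / (lambdaEps lam ε d) ^ (1 / 4 : ℝ)

/-- The six "large-field" events of (2.2) at a point / bond / block (any one of them triggers the small factor
(2.3)): DICTIONARY `devB` ↤ |B(y) − (QA)(y)|, `dA` ↤ |(∂A)(b)|, `absA` ↤ |A(x)|, `devPsi` ↤ |ψ(y) − (Q(A)φ)(y)|, `dPhi` ↤
|(D_Aφ)(b)|, `absPhi` ↤ |φ(x)|; thresholds p(ε), p(ε), p(ε)/(μ₀ε), p(ε), p(ε), p(ε)/λ(ε)^{1/4}.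
[cite: Balaban1982Higgs2, (2.2) p.557] -/
def LargeField (μ₀ lam ε : ℝ) (d : ℕ) (pε devB dA absA devPsi dPhi absPhi : ℝ) : Prop :=
  pε < devB ∨ pε < dA ∨ thrA μ₀ ε pε < absA ∨ pε < devPsi ∨ pε < dPhi ∨ thrPhi lam ε d pε < absPhi

/-- The complementary "small-field" event (all six quantities within their thresholds) — the restrictions the
characteristic functions χ_{P^c}, χ_{Q^c}, χ_{R^c} of (2.4)–(2.5) impose. [cite: Balaban1982Higgs2, (2.2), (2.4)–(2.5) p.557] -/
def SmallField (μ₀ lam ε : ℝ) (d : ℕ) (pε devB dA absA devPsi dPhi absPhi : ℝ) : Prop :=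
  devB ≤ pε ∧ dA ≤ pε ∧ absA ≤ thrA μ₀ ε pε ∧ devPsi ≤ pε ∧ dPhi ≤ pε ∧ absPhi ≤ thrPhi lam ε d pε

/-- Small field = not large field (the dichotomy behind the partitions of unity (2.4)–(2.6)). KERNEL.
[cite: Balaban1982Higgs2, (2.2)–(2.6) pp.557–558] -/
theorem smallField_iff_not_largeField (μ₀ lam ε : ℝ) (d : ℕ) (pε devB dA absA devPsi dPhi absPhi : ℝ) :
    SmallField μ₀ lam ε d pε devB dA absA devPsi dPhi absPhi ↔
      ¬ LargeField μ₀ lam ε d pε devB dA absA devPsi dPhi absPhi := by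
  simp only [SmallField, LargeField, not_or, not_lt]

/-- **(2.3)** p. 557 and the remark after it, TYPED: *"exp(−c₀p(ε)²) is smaller than the arbitrary power ε^K"* —
for p(ε) = b₀(1 + log ε⁻¹)^p with p > 2 (`B2.pFn`): for every K there is an ε-threshold below which
exp(−c₀p(ε)²) ≤ ε^K.  Elementary real analysis; PROVED below for every c₀, b₀ > 0 and p > ½ (`expPSqSmall`,
`expPSqSmall_of_printed`; v1.1). [cite: Balaban1982Higgs2, (2.3) p.557] -/
def ExpPSqSmall (c₀ b₀ p : ℝ) : Prop :=
  ∀ K : ℕ, ∃ ε₁ : ℝ, 0 < ε₁ ∧ ∀ ε : ℝ, 0 < ε → ε ≤ ε₁ →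
    Real.exp (-(c₀ * B2.pFn b₀ p ε ^ 2)) ≤ ε ^ K

/-! ## (2.4)–(2.6) pp. 557–558: the partitions of unity — KERNEL -/

/-- The identity behind (2.4), (2.5), (2.6): for indicator-like weights with χ^c_y + χ_y = 1 at every y ∈ S,
Σ_{P⊂S} Π_{y∈P}χ^c_y · Π_{y∈S∖P}χ_y = 1 (expand Π_{y∈S}(χ^c_y + χ_y) = 1; Mathlib `Finset.prod_add`).  KERNEL.
DICTIONARY: `S` ↤ T′₁ (blocks y), T*₁ (bonds b) or T₁ (points x); `big y` ↤ χ({… > threshold}), `small y` ↤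
χ({… ≤ threshold}). [cite: Balaban1982Higgs2, (2.4) p.557] -/
theorem sum_powerset_prod_eq_one {ι R : Type*} [DecidableEq ι] [CommSemiring R] (S : Finset ι) (big small : ι → R)
    (h : ∀ y ∈ S, big y + small y = 1) :
    ∑ P ∈ S.powerset, (∏ y ∈ P, big y) * ∏ y ∈ S \ P, small y = 1 := by
  rw [← Finset.prod_add]
  exact Finset.prod_eq_one h

/-- For genuine indicators (values in {0,1} of a decidable event and its negation) the hypothesis χ^c + χ = 1 holds.
KERNEL. [cite: Balaban1982Higgs2, (2.4) p.557] -/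
theorem indicator_add_compl {ι : Type*} (E : ι → Prop) [DecidablePred E] (y : ι) :
    (if E y then (1 : ℝ) else 0) + (if E y then 0 else 1) = 1 := by
  split_ifs <;> norm_num

/-- **(2.4)** p. 557 (and likewise (2.5); (2.6) p. 558 is their product), KERNEL: the triple sum over P_v ⊂ T′₁,
Q_v ⊂ T*₁, R_v ⊂ T₁ of the products of indicators equals 1 — three independent instances of
`sum_powerset_prod_eq_one` multiplied.  DICTIONARY: `SP`, `SQ`, `SR` ↤ T′₁, T*₁, T₁; `bP`/`sP` ↤ χ({|B(y) − (QA)(y)| >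
p(ε)})/χ({… ≤ p(ε)}), `bQ`/`sQ` ↤ the indicators for |(∂A)(b)|, `bR`/`sR` ↤ those for |A(x)| vs (1/(μ₀ε))p(ε).
[cite: Balaban1982Higgs2, (2.4)–(2.6) pp.557–558] -/
theorem partition24 {α β γ R : Type*} [DecidableEq α] [DecidableEq β] [DecidableEq γ] [CommSemiring R]
    (SP : Finset α) (SQ : Finset β) (SR : Finset γ) (bP sP : α → R) (bQ sQ : β → R) (bR sR : γ → R)
    (hP : ∀ y ∈ SP, bP y + sP y = 1) (hQ : ∀ b ∈ SQ, bQ b + sQ b = 1) (hR : ∀ x ∈ SR, bR x + sR x = 1) :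
    ∑ P ∈ SP.powerset, ∑ Q ∈ SQ.powerset, ∑ Rv ∈ SR.powerset,
      ((∏ y ∈ P, bP y) * ∏ y ∈ SP \ P, sP y) * ((∏ b ∈ Q, bQ b) * ∏ b ∈ SQ \ Q, sQ b) *
        ((∏ x ∈ Rv, bR x) * ∏ x ∈ SR \ Rv, sR x) = 1 := by
  have h1 := sum_powerset_prod_eq_one SP bP sP hP
  have h2 := sum_powerset_prod_eq_one SQ bQ sQ hQ
  have h3 := sum_powerset_prod_eq_one SR bR sR hR
  simp_rw [← Finset.mul_sum, ← Finset.sum_mul, ← Finset.mul_sum, ← Finset.sum_mul]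
  rw [h1, h2, h3]
  ring

/-! ## (2.7)–(2.8) p. 558: the small-field regions Λ₀ ⊃ Λ₁ ⊃ Λ₂ ⊃ … (typed through their complements) -/

/-- **(2.7)** p. 558: *"Λ₀^c is the sum of all large blocks of T₁ distant from one of the sets B(P_v), Q_v, R_v, B(P_s),
Q_s, R_s less than r(ε)"* — DICTIONARY: `Blk` ↤ the large blocks of T₁, `Bad` ↤ the elements of B(P_v) ∪ Q_v ∪ R_v ∪
B(P_s) ∪ Q_s ∪ R_s (blocks, bonds, points), `bdist b z` ↤ the lattice distance from the block b to z, `r` ↤ r(ε) =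
`B2.rFn R r ε`. [cite: Balaban1982Higgs2, (2.7) p.558] -/
def lambda0Compl {Blk Bad : Type*} (bdist : Blk → Bad → ℝ) (bad : Set Bad) (r : ℝ) : Set Blk :=
  {b | ∃ z ∈ bad, bdist b z < r}

/-- **(2.8)** p. 558: *"Λ^c_{i+1} is the sum of all large blocks of T₁ with distances from the set Λ^c_i less or equal
r(ε)"* — one step of the induction, on complements; `ddist b b′` ↤ the distance between large blocks.
[cite: Balaban1982Higgs2, (2.8) p.558] -/
def lambdaSuccCompl {Blk : Type*} (ddist : Blk → Blk → ℝ) (r : ℝ) (Λc : Set Blk) : Set Blk :=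
  {b | ∃ b' ∈ Λc, ddist b b' ≤ r}

/-- The whole sequence Λ₀^c, Λ₁^c, Λ₂^c, … of (2.7)–(2.8) (the regions Λ_i are the complements; the paper uses Λ₀, …,
Λ₇ and their primed/starred versions). [cite: Balaban1982Higgs2, (2.7)–(2.8) p.558] -/
def lambdaCompl {Blk Bad : Type*} (bdist : Blk → Bad → ℝ) (ddist : Blk → Blk → ℝ) (bad : Set Bad) (r : ℝ) :
    ℕ → Set Blk
  | 0 => lambda0Compl bdist bad r
  | i + 1 => lambdaSuccCompl ddist r (lambdaCompl bdist ddist bad r i)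

/-- The complements increase, Λ^c_i ⊆ Λ^c_{i+1} (i.e. Λ_{i+1} ⊆ Λ_i), as soon as every block is at distance ≤ r(ε)
from itself (ddist b b = 0 ≤ r). KERNEL. [cite: Balaban1982Higgs2, (2.8) p.558] -/
theorem lambdaCompl_mono {Blk Bad : Type*} (bdist : Blk → Bad → ℝ) (ddist : Blk → Blk → ℝ) (bad : Set Bad)
    {r : ℝ} (hself : ∀ b, ddist b b ≤ r) (i : ℕ) :
    lambdaCompl bdist ddist bad r i ⊆ lambdaCompl bdist ddist bad r (i + 1) := by
  intro b hb
  exact ⟨b, hb, hself b⟩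

/-- Hence Λ^c_i ⊆ Λ^c_j for i ≤ j (the regions Λ_j shrink). KERNEL. [cite: Balaban1982Higgs2, (2.8) p.558] -/
theorem lambdaCompl_mono_of_le {Blk Bad : Type*} (bdist : Blk → Bad → ℝ) (ddist : Blk → Blk → ℝ) (bad : Set Bad)
    {r : ℝ} (hself : ∀ b, ddist b b ≤ r) {i j : ℕ} (hij : i ≤ j) :
    lambdaCompl bdist ddist bad r i ⊆ lambdaCompl bdist ddist bad r j := by
  induction hij with
  | refl => exact le_rfl
  | step _ ih => exact ih.trans (lambdaCompl_mono bdist ddist bad hself _)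

/-! ## (2.11)–(2.12) p. 559: positivity of the quartic-plus-counterterm — KERNEL as elementary inequalities -/

/-- The elementary inequality behind (2.11): for λ′ > 0 and any real m, λ′s² + ms ≥ −m²/(4λ′) for all s (here s ↤
|φ|², λ′ ↤ λ(ε), m ↤ ½δm²ε²). KERNEL. [cite: Balaban1982Higgs2, (2.11) p.559] -/
theorem quartic_quadratic_lower {lam' : ℝ} (hl : 0 < lam') (m s : ℝ) :
    -(m ^ 2 / (4 * lam')) ≤ lam' * s ^ 2 + m * s := by
  have h : 0 ≤ lam' * (s + m / (2 * lam')) ^ 2 := by positivity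
  have e : lam' * (s + m / (2 * lam')) ^ 2 = lam' * s ^ 2 + m * s + m ^ 2 / (4 * lam') := by
    field_simp
    ring
  linarith [e ▸ h]

/-- **(2.11)** p. 559, KERNEL modulo the printed bounds on the counterterm: if λ(ε) > 0 and the coefficient
m = ½δm²ε² satisfies m² ≤ 4λ(ε)·Cε^{κ₀} (which is what *"δm² = O(ε⁻¹) for d = 3 and δm² = O(1 + log ε⁻¹) for d = 2"*
give, with κ₀ = 1, resp. κ₀ = 2 − α — bounds proved in B3), then λ(ε)|φ|⁴ + ½δm²ε²|φ|² ≥ −Cε^{κ₀}.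
[cite: Balaban1982Higgs2, (2.11) p.559] -/
theorem display211 {lam' m C ε κ₀ : ℝ} (hl : 0 < lam') (hm : m ^ 2 ≤ 4 * lam' * (C * ε ^ κ₀)) (t : ℝ) :
    -(C * ε ^ κ₀) ≤ lam' * (t ^ 2) ^ 2 + m * t ^ 2 := by
  have h1 := quartic_quadratic_lower hl m (t ^ 2)
  have h2 : m ^ 2 / (4 * lam') ≤ C * ε ^ κ₀ := by
    rw [div_le_iff₀ (by positivity)]
    linarith
  linarith

/-- **(2.12)** p. 559, KERNEL: λ′s² + ms ≥ ½λ′s² as soon as s ≥ −2m/λ′ and s ≥ 0 (s ↤ |φ|²; the printed threshold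
*"|φ|² ≥ O(1)(1 + log ε⁻¹)"* is −2m/λ(ε) = −δm²ε²/λ(ε) under the printed bounds on δm²). [cite: Balaban1982Higgs2, (2.12) p.559] -/
theorem quartic_quadratic_half {lam' m s : ℝ} (hl : 0 < lam') (hs : 0 ≤ s) (hms : -(2 * m / lam') ≤ s) :
    lam' * s ^ 2 / 2 ≤ lam' * s ^ 2 + m * s := by
  have h : -m ≤ lam' * s / 2 := by
    rw [neg_le] at hms ⊢
    have := mul_le_mul_of_nonneg_left hms hl.le
    have e : lam' * (2 * m / lam') = 2 * m := by field_simp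
    nlinarith [e]
  nlinarith

/-! ## (2.16)–(2.17) pp. 559–560: small fields stay close along contours — KERNEL -/

section Transport

variable {V : Type*} [NormedAddCommGroup V]

/-- **The telescoping estimate of p. 559**, KERNEL: *"|U(A(Γ_{y,x}))φ(x) − φ(y)| = |Σ_{b⊂Γ_{y,x}}U(A(Γ_{y,b₋}))(D_Aφ)(b)|
≤ Σ_{b⊂Γ_{y,x}}|(D_Aφ)(b)|"*.  DICTIONARY: the contour Γ_{y,x} = (z₀ = y, z₁, …, z_m = x); `φ i` ↤ φ(z_i); `u i` ↤ the
parallel transport U(A(Γ_{y,z_i})) from z_i back to y (u 0 = identity; each u i an ISOMETRY of V = R^N — U is unitary,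
p. 605 of B1); `covD i` ↤ (D_Aφ)(b_i) = U(A_{b_i})φ(z_{i+1}) − φ(z_i) transported so that u (i+1) (φ (i+1)) − u i (φ i) =
u i applied to it (`hstep`).  Conclusion: ‖u m (φ m) − φ 0‖ ≤ Σ_{i<m}‖covD i‖. [cite: Balaban1982Higgs2, (2.16) p.559] -/
theorem norm_transport_sub_le (m : ℕ) (φ : ℕ → V) (u : ℕ → V → V) (covD : ℕ → V)
    (hu0 : ∀ v, u 0 v = v) (hiso : ∀ i v w, ‖u i v - u i w‖ = ‖v - w‖)
    (hstep : ∀ i, u (i + 1) (φ (i + 1)) = u i (φ i + covD i)) :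
    ‖u m (φ m) - φ 0‖ ≤ ∑ i ∈ range m, ‖covD i‖ := by
  have h := dist_le_range_sum_dist (fun i => u i (φ i)) m
  rw [dist_comm, dist_eq_norm, hu0] at h
  refine h.trans (le_of_eq (Finset.sum_congr rfl fun i _ => ?_))
  rw [dist_comm, dist_eq_norm, hstep i, hiso i]
  simp

/-- Hence, with every covariant derivative along the contour bounded by p and the contour of length m:
‖U(A(Γ_{y,x}))φ(x) − φ(y)‖ ≤ m·p — for the contours Γ_{y,x} of (I.2.1) inside a block, m ≤ (L − 1)d, giving the printed
*"≤ (L − 1)dp(ε)"*. KERNEL. [cite: Balaban1982Higgs2, (2.16) p.559] -/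
theorem norm_transport_sub_le_mul (m : ℕ) (φ : ℕ → V) (u : ℕ → V → V) (covD : ℕ → V) {p : ℝ}
    (hu0 : ∀ v, u 0 v = v) (hiso : ∀ i v w, ‖u i v - u i w‖ = ‖v - w‖)
    (hstep : ∀ i, u (i + 1) (φ (i + 1)) = u i (φ i + covD i)) (hp : ∀ i, i < m → ‖covD i‖ ≤ p) :
    ‖u m (φ m) - φ 0‖ ≤ m * p := by
  refine (norm_transport_sub_le m φ u covD hu0 hiso hstep).trans ?_
  calc ∑ i ∈ range m, ‖covD i‖ ≤ ∑ _i ∈ range m, p := Finset.sum_le_sum fun i hi => hp i (mem_range.1 hi)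
    _ = m * p := by simp

variable [NormedSpace ℝ V]

/-- **The averaging step of p. 559**, KERNEL: if every transported value is within δ of φ(y) and the weights are
w = 1/|B(y)| (so that w·|B(y)| = 1, as L^{−d}·L^d = 1 in (I.2.7)), then *"|(Q(A)φ)(y) − φ(y)| ≤ (L − 1)dp(ε)"*:
‖wΣ_{x∈B}T_x − φ(y)‖ ≤ δ.  DICTIONARY: `T x` ↤ U(A(Γ_{y,x}))φ(x), `δ` ↤ (L − 1)dp(ε). [cite: Balaban1982Higgs2, (2.16) p.559] -/
theorem norm_blockAvg_sub_le {X : Type*} (B : Finset X) (hB : B.Nonempty) (T : X → V) (φy : V) {δ : ℝ}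
    (hT : ∀ x ∈ B, ‖T x - φy‖ ≤ δ) :
    ‖(B.card : ℝ)⁻¹ • (∑ x ∈ B, T x) - φy‖ ≤ δ := by
  have hc : (0 : ℝ) < B.card := by exact_mod_cast hB.card_pos
  have e : (B.card : ℝ)⁻¹ • (∑ x ∈ B, T x) - φy = (B.card : ℝ)⁻¹ • ∑ x ∈ B, (T x - φy) := by
    rw [Finset.sum_sub_distrib, Finset.sum_const, smul_sub, ← Nat.cast_smul_eq_nsmul ℝ, smul_smul,
      inv_mul_cancel₀ hc.ne', one_smul]
  rw [e, norm_smul, Real.norm_of_nonneg (inv_nonneg.2 hc.le)]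
  calc (B.card : ℝ)⁻¹ * ‖∑ x ∈ B, (T x - φy)‖
      ≤ (B.card : ℝ)⁻¹ * ∑ x ∈ B, ‖T x - φy‖ := by
        gcongr
        exact norm_sum_le _ _
    _ ≤ (B.card : ℝ)⁻¹ * ∑ _x ∈ B, δ := by
        gcongr with x hx
        exact hT x hx
    _ = δ := by
        rw [Finset.sum_const, nsmul_eq_mul]
        field_simp

omit [NormedSpace ℝ V] in
/-- **(2.16), first two printed consequences** p. 559, KERNEL: from |(Q(A)φ)(y) − φ(y)| ≤ (L − 1)dp(ε)
(`norm_blockAvg_sub_le` with `norm_transport_sub_le_mul`) and the small-field restriction |ψ(y) − (Q(A)φ)(y)| ≤ p(ε):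
*"|ψ(y) − φ(y)| ≤ Ldp(ε)"* (indeed ≤ ((L − 1)d + 1)p(ε) ≤ Ldp(ε) for d ≥ 1). DICTIONARY: `ψy` ↤ ψ(y), `Qφy` ↤ (Q(A)φ)(y),
`φy` ↤ φ(y). [cite: Balaban1982Higgs2, (2.16) pp.559–560] -/
theorem display216a {ψy Qφy φy : V} {L d p : ℝ} (hd : 1 ≤ d) (hp : 0 ≤ p)
    (h1 : ‖ψy - Qφy‖ ≤ p) (h2 : ‖Qφy - φy‖ ≤ (L - 1) * d * p) :
    ‖ψy - φy‖ ≤ L * d * p := by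
  calc ‖ψy - φy‖ = ‖(ψy - Qφy) + (Qφy - φy)‖ := by rw [sub_add_sub_cancel]
    _ ≤ ‖ψy - Qφy‖ + ‖Qφy - φy‖ := norm_add_le _ _
    _ ≤ p + (L - 1) * d * p := add_le_add h1 h2
    _ ≤ L * d * p := by nlinarith

omit [NormedSpace ℝ V] in
/-- **(2.16), third consequence** p. 559, KERNEL: *"|ψ(y) − U(A(Γ_{y,x}))φ(x)| ≤ 2Ldp(ε)"* from |ψ(y) − φ(y)| ≤ Ldp(ε) and
|U(A(Γ_{y,x}))φ(x) − φ(y)| ≤ (L − 1)dp(ε) ≤ Ldp(ε). DICTIONARY: `Tφx` ↤ U(A(Γ_{y,x}))φ(x). [cite: Balaban1982Higgs2, (2.16) pp.559–560] -/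
theorem display216b {ψy φy Tφx : V} {L d p : ℝ} (hd : 0 ≤ d) (hp : 0 ≤ p)
    (h1 : ‖ψy - φy‖ ≤ L * d * p) (h2 : ‖Tφx - φy‖ ≤ (L - 1) * d * p) :
    ‖ψy - Tφx‖ ≤ 2 * L * d * p := by
  calc ‖ψy - Tφx‖ = ‖(ψy - φy) - (Tφx - φy)‖ := by rw [sub_sub_sub_cancel_right]
    _ ≤ ‖ψy - φy‖ + ‖Tφx - φy‖ := norm_sub_le _ _
    _ ≤ L * d * p + (L - 1) * d * p := add_le_add h1 h2
    _ ≤ 2 * L * d * p := by nlinarith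

end Transport

/-! ## (2.3) p. 557, the remark *"exp(−c₀p(ε)²) is smaller than the arbitrary power ε^K"* — PROOF (v1.1)

p. 557 [PDF 3], verbatim: *"The function p(ε) has the form p(ε) = b₀(1 + log ε⁻¹)^p … exp(−c₀p(ε)²) … is smaller
than the arbitrary power ε^K for ε sufficiently small"*.  The proof is the one-line growth comparison the text leaves
to the reader: with t = log ε⁻¹ ≥ 0, ε^K = e^{−Kt} and c₀p(ε)² = c₀b₀²(1 + t)^{2p}; since 2p > 1,
(1 + t)^{2p} = (1 + t)(1 + t)^{2p−1} ≥ t·(1 + T)^{2p−1} ≥ t·K/(c₀b₀²) as soon as t ≥ T := (K/c₀b₀²)^{1/(2p−1)}. -/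

section ExpPSqSmallProof

/-- The growth comparison behind (2.3)/(2.109): for a > 0, s > 1 and any real κ there is T ≥ 0 with κt ≤ a(1 + t)^s for
all t ≥ T (T = 0 if κ ≤ 0, else T = (κ/a)^{1/(s−1)}, using (1 + t)^s = (1 + t)(1 + t)^{s−1} ≥ t(1 + T)^{s−1}).
[cite: Balaban1982Higgs2, (2.3) p.557] -/
theorem linear_le_mul_rpow_eventually {a s : ℝ} (ha : 0 < a) (hs : 1 < s) (κ : ℝ) :
    ∃ T : ℝ, 0 ≤ T ∧ ∀ t : ℝ, T ≤ t → κ * t ≤ a * (1 + t) ^ s := by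
  by_cases hκ : κ ≤ 0
  · refine ⟨0, le_rfl, fun t ht => ?_⟩
    have h1 : 0 ≤ a * (1 + t) ^ s := mul_nonneg ha.le (Real.rpow_nonneg (by linarith) _)
    exact (mul_nonpos_of_nonpos_of_nonneg hκ ht).trans h1
  push Not at hκ
  have hs1 : 0 < s - 1 := by linarith
  set M : ℝ := κ / a with hM
  have hMpos : 0 < M := div_pos hκ ha
  refine ⟨M ^ (s - 1)⁻¹, Real.rpow_nonneg hMpos.le _, fun t ht => ?_⟩
  have hT0 : 0 ≤ M ^ (s - 1)⁻¹ := Real.rpow_nonneg hMpos.le _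
  have h1t : 0 < 1 + t := by linarith
  have hsplit : (1 + t) ^ s = (1 + t) * (1 + t) ^ (s - 1) := by
    conv_lhs => rw [show s = 1 + (s - 1) by ring]
    rw [Real.rpow_add h1t, Real.rpow_one]
  have hlow : M ≤ (1 + t) ^ (s - 1) := by
    calc M = (M ^ (s - 1)⁻¹) ^ (s - 1) := (Real.rpow_inv_rpow hMpos.le hs1.ne').symm
      _ ≤ (1 + t) ^ (s - 1) := Real.rpow_le_rpow hT0 (by linarith) hs1.le
  calc κ * t = a * (t * M) := by rw [hM]; field_simp
    _ ≤ a * ((1 + t) * (1 + t) ^ (s - 1)) := by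
        apply mul_le_mul_of_nonneg_left _ ha.le
        exact mul_le_mul (by linarith) hlow hMpos.le h1t.le
    _ = a * (1 + t) ^ s := by rw [hsplit]

/-- **(2.3) remark** p. 557, KERNEL: `ExpPSqSmall c₀ b₀ p` holds for every c₀ > 0 (*"some positive constant c₀"*),
b₀ > 0 and p > ½ (the print has p > 2, `B2.Params.Printed`): for each K, exp(−c₀p(ε)²) ≤ ε^K once
0 < ε ≤ ε₁ := e^{−T} with the T of `linear_le_mul_rpow_eventually` for a = c₀b₀², s = 2p, κ = K.
[cite: Balaban1982Higgs2, (2.3) p.557] -/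
theorem expPSqSmall {c₀ b₀ p : ℝ} (hc : 0 < c₀) (hb : 0 < b₀) (hp : 1 / 2 < p) : ExpPSqSmall c₀ b₀ p := by
  intro K
  have ha : 0 < c₀ * b₀ ^ 2 := by positivity
  have hs : (1 : ℝ) < 2 * p := by linarith
  obtain ⟨T, hT0, hT⟩ := linear_le_mul_rpow_eventually ha hs (K : ℝ)
  refine ⟨Real.exp (-T), Real.exp_pos _, fun ε hε hεT => ?_⟩
  set t : ℝ := Real.log ε⁻¹ with ht
  have htT : T ≤ t := by
    have h1 : Real.log ε ≤ -T := by
      have := Real.log_le_log hε hεT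
      rwa [Real.log_exp] at this
    rw [ht, Real.log_inv]
    linarith
  have h1t : 0 ≤ 1 + t := by linarith
  have hsq : B2.pFn b₀ p ε ^ 2 = b₀ ^ 2 * (1 + t) ^ (2 * p) := by
    rw [B2.pFn, ← ht, mul_pow]
    congr 1
    rw [show 2 * p = p * 2 by ring, Real.rpow_mul h1t, Real.rpow_two]
  have hK : ε ^ K = Real.exp (-((K : ℝ) * t)) := by
    rw [ht, Real.log_inv, mul_neg, neg_neg, Real.exp_nat_mul, Real.exp_log hε]
  rw [hK, Real.exp_le_exp, hsq, neg_le_neg_iff, ← mul_assoc]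
  exact hT t htT

/-- (2.3) remark for the PRINTED parameter ranges (`B2.Params.Printed`: p > 2, b₀ > 0) and any c₀ > 0. KERNEL.
[cite: Balaban1982Higgs2, (2.3) p.557] -/
theorem expPSqSmall_of_printed (P : B2.Params) (hP : P.Printed) {c₀ : ℝ} (hc : 0 < c₀) :
    ExpPSqSmall c₀ P.b₀ P.p := by
  obtain ⟨hp, -, -, -, -, -, hb, -⟩ := hP
  exact expPSqSmall hc hb (by linarith)

end ExpPSqSmallProof

/-! ## (2.7)–(2.8) p. 558, the geometry of the regions (v1.2): SEPARATION — Λ₀ is at distance ≥ r(ε) from the bad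
sets, Λ_{i+1} is at distance > r(ε) from Λ_iᶜ, hence Λ_j from every Λ_iᶜ with i < j

v1.2 (unit `lit-balaban-r14` gen 4, 2026-08-21; APPEND-ONLY, theorems only).  These are the properties of the regions the
text uses after (2.8) (p. 558: *"sets Λ′_i … r(ε)-neighbourhoods"*; p. 571 Lemma 2.5 / p. 580 (2.109): points of the
inner regions are farther than r(L^kε) from the complements of the outer ones) — immediate from the definitions
`lambda0Compl`/`lambdaSuccCompl`/`lambdaCompl` above, recorded so that the SKELETON member «Λ_i geometry» of row B2.Eq2.7
has kernel statements. [cite: Balaban1982Higgs2, (2.7)–(2.8) p.558]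
-/

section Geometry

variable {Blk Bad : Type*}

/-- **(2.7), separation**: a block belongs to Λ₀ (i.e. not to Λ₀ᶜ) iff it is at distance `≥ r(ε)` from every element of
the bad sets B(P_v) ∪ Q_v ∪ R_v ∪ B(P_s) ∪ Q_s ∪ R_s. KERNEL (definitional). [cite: Balaban1982Higgs2, (2.7) p.558] -/
theorem not_mem_lambda0Compl_iff (bdist : Blk → Bad → ℝ) (bad : Set Bad) (r : ℝ) (b : Blk) :
    b ∉ lambda0Compl bdist bad r ↔ ∀ z ∈ bad, r ≤ bdist b z := by
  simp only [lambda0Compl, Set.mem_setOf_eq, not_exists, not_and, not_lt]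

/-- **(2.8), separation**: a block belongs to Λ_{i+1} (i.e. not to Λ_{i+1}ᶜ) iff it is at distance `> r(ε)` from every
block of Λ_iᶜ. KERNEL (definitional). [cite: Balaban1982Higgs2, (2.8) p.558] -/
theorem not_mem_lambdaSuccCompl_iff (ddist : Blk → Blk → ℝ) (r : ℝ) (Λc : Set Blk) (b : Blk) :
    b ∉ lambdaSuccCompl ddist r Λc ↔ ∀ b' ∈ Λc, r < ddist b b' := by
  simp only [lambdaSuccCompl, Set.mem_setOf_eq, not_exists, not_and, not_le]

/-- The regions along the sequence: `b ∈ Λ_{i+1}` iff `b` is farther than `r(ε)` from every block of `Λ_iᶜ`.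
KERNEL. [cite: Balaban1982Higgs2, (2.8) p.558] -/
theorem not_mem_lambdaCompl_succ_iff (bdist : Blk → Bad → ℝ) (ddist : Blk → Blk → ℝ) (bad : Set Bad) (r : ℝ)
    (i : ℕ) (b : Blk) :
    b ∉ lambdaCompl bdist ddist bad r (i + 1) ↔ ∀ b' ∈ lambdaCompl bdist ddist bad r i, r < ddist b b' :=
  not_mem_lambdaSuccCompl_iff ddist r _ b

/-- **Separation across levels**: a block of `Λ_j` is at distance `> r(ε)` from every block of `Λ_iᶜ` for all `i < j`
(the complements increase, `lambdaCompl_mono_of_le`, and `Λ_j` is separated from `Λ_{j−1}ᶜ`). KERNEL.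
[cite: Balaban1982Higgs2, (2.8) p.558] -/
theorem lambdaCompl_far {bdist : Blk → Bad → ℝ} {ddist : Blk → Blk → ℝ} {bad : Set Bad} {r : ℝ}
    (hself : ∀ b, ddist b b ≤ r) {i j : ℕ} (hij : i < j) {b b' : Blk}
    (hb : b ∉ lambdaCompl bdist ddist bad r j) (hb' : b' ∈ lambdaCompl bdist ddist bad r i) : r < ddist b b' := by
  obtain ⟨j', rfl⟩ := Nat.exists_eq_add_of_lt hij
  have hmem : b' ∈ lambdaCompl bdist ddist bad r (i + j') :=
    lambdaCompl_mono_of_le bdist ddist bad hself (Nat.le_add_right i j') hb'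
  exact (not_mem_lambdaCompl_succ_iff bdist ddist bad r (i + j') b).1 hb b' hmem

/-- A block of any `Λ_j` is at distance `≥ r(ε)` from the bad sets (it lies in Λ₀). KERNEL. [cite: Balaban1982Higgs2, (2.7)–(2.8) p.558] -/
theorem lambdaCompl_far_bad {bdist : Blk → Bad → ℝ} {ddist : Blk → Blk → ℝ} {bad : Set Bad} {r : ℝ}
    (hself : ∀ b, ddist b b ≤ r) (j : ℕ) {b : Blk} (hb : b ∉ lambdaCompl bdist ddist bad r j) {z : Bad}
    (hz : z ∈ bad) : r ≤ bdist b z := by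
  have h0 : b ∉ lambdaCompl bdist ddist bad r 0 := fun h =>
    hb (lambdaCompl_mono_of_le bdist ddist bad hself (Nat.zero_le j) h)
  exact (not_mem_lambda0Compl_iff bdist bad r b).1 h0 z hz

/-- The complements are UNIONS OF LARGE BLOCKS closed under «being within r(ε)»: if `b′ ∈ Λ_iᶜ` and `ddist b b′ ≤ r(ε)` then
`b ∈ Λ_{i+1}ᶜ` (the defining clause of (2.8), as an introduction rule). KERNEL. [cite: Balaban1982Higgs2, (2.8) p.558] -/
theorem mem_lambdaCompl_succ_of_near {bdist : Blk → Bad → ℝ} {ddist : Blk → Blk → ℝ} {bad : Set Bad} {r : ℝ}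
    (i : ℕ) {b b' : Blk} (hb' : b' ∈ lambdaCompl bdist ddist bad r i) (hnear : ddist b b' ≤ r) :
    b ∈ lambdaCompl bdist ddist bad r (i + 1) :=
  ⟨b', hb', hnear⟩

end Geometry

end Literature.MathematicalPhysics.QuantumFieldTheory.Balaban1983to89.B2LargeField
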